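import Summits.QuantumFields.BalabanUV.Beta.AxialDressingRootedBmKernel

/-!
# PREPARATORY (pending β-lead RULING (R42-1); touches NO wall object): the BLOCK-MEAN window operator `coProjBmAt`, the leg
# dressings in window form = the comp-form dressing of file 1, and their same-rate bi-localisation bounds

HONEST FRAMING (cell charter, verbatim): «discharging BetaPertH makes Balaban's UV stability UNCONDITIONAL — a real
constructive-QFT result; it is NOT the continuum limit and NOT the Clay problem.»  DERIVED cell leaf (β sub-cell, lane an2 gen 12,
NOTE X-an2-42 repair (A), file 2); no statement of Bałaban's papers, no `[cite:]` tag, no `Prop` fact; instantiates no wall binder.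
NOT `BetaPertH`; NOT continuum; NOT Clay.

## What is here (decl-by-decl twins of `AxialDressingRooted` §2–§3 and `AxialDressingRootedLegs` §4–§5 with `pm ↦ pmBm`)
* §1 `coProjBmAt ρ N g α q := Σ_{v ∈ cube} Σ_β pmBm ρ N β (q+v) α q · g β (q+v)`, the window constant `cWb`, `abs_coProjBmAt_le`,
  `coProjBmAt_shift`.
* §2 `legCo₁BmAt`, `legCo₂BmAt` (window form), the four fibre-contraction rules of `piKBm`, and the identification with the comp-form
  dressing of file 1: `legCo₁BmAt_eq_comp : legCo₁BmAt ρ N K = comp (piKBm ρ N) K`,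
  `legCo₂BmAt_eq_comp : legCo₂BmAt ρ N K = comp K (trK (piKBm ρ N))`, `dressKBmAt_eq_legs : dressKBmAt ρ N K = legCo₂BmAt ρ N (legCo₁BmAt ρ N K)`.
* §3 `biLoc_legCo₁BmAt` / `biLoc_legCo₂BmAt` / `biLoc_dressKBmAt` (constant `cKb d N δ := cWb·exp(δ(d+1)N)` per leg; SAME rate).
All declarations `[folklore]`; axioms standard.  Provenance: b2b-balaban β sub-cell, unit beta-an2 gen 12, 2026-08-20.
-/

open Finset
open scoped BigOperators
open Literature.MathematicalPhysics.QuantumFieldTheory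
open Literature.MathematicalPhysics.QuantumFieldTheory.Balaban1983to89
open Literature.MathematicalPhysics.QuantumFieldTheory.Balaban1983to89.Beta
open B12Sec2to5 (l1 l1_nonneg)
open ExpKernelCalculus (MKer Decays BiLoc comp tr shiftK l1_sub_triangle l1_sub_symm)
open AffineAveraging (Form0 Form1 box toSite unitVec unitVec_apply)
open AveragingContoursRooted (ctrOff ctrOff_mem_box)
open AxialDressing (exp_recenter_le)
open OneStepResolventKernel (Fib LocStencil JetData)
open Summit.QuantumFields.BalabanUV.Beta.TameKernelCalculus

namespace Summit.QuantumFields.BalabanUV.Beta.AxialDressingRooted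

noncomputable section

variable {d : ℕ}

/-! ## §1 The block-mean window operator `coProjBmAt` -/

section Window

/-- [folklore] **THE BLOCK-MEAN WINDOW OPERATOR `Πᵀ_bm` ON REAL ONE-FORMS**: `(Πᵀ_bm g)_α(q) = Σ_{v ∈ cube} Σ_β pmBm ρ N β (q+v) α q · g_β(q+v)`. -/
def coProjBmAt (ρ : Fin (d + 1) → ℤ) (N : ℕ) (g : Form1 (d + 1) ℝ) : Form1 (d + 1) ℝ :=
  fun α q => ∑ v ∈ cube (d + 1) N, ∑ β : Fin (d + 1), pmBm ρ N β (q + v) α q * g β (q + v)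

/-- [folklore] Pointwise form of `coProjBmAt`. -/
theorem coProjBmAt_apply (ρ : Fin (d + 1) → ℤ) (N : ℕ) (g : Form1 (d + 1) ℝ) (α : Fin (d + 1)) (q : Fin (d + 1) → ℤ) :
    coProjBmAt ρ N g α q = ∑ v ∈ cube (d + 1) N, ∑ β : Fin (d + 1), pmBm ρ N β (q + v) α q * g β (q + v) := rfl

/-- [folklore] The block-mean window constant `cWb d N := (2N+1)^{d+1} · (d+1) · (1 + 4·(d+1)·N)`. -/
def cWb (d N : ℕ) : ℝ := (((2 * N + 1) ^ (d + 1) : ℕ) : ℝ) * (((d : ℝ) + 1) * (1 + 4 * (((d : ℝ) + 1) * N)))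

/-- [folklore] `0 ≤ cWb`. -/
theorem cWb_nonneg (d N : ℕ) : 0 ≤ cWb d N := by
  unfold cWb
  positivity

/-- [folklore] `1 ≤ cWb`. -/
theorem one_le_cWb (d N : ℕ) : 1 ≤ cWb d N := by
  have h1 : (1 : ℝ) ≤ (((2 * N + 1) ^ (d + 1) : ℕ) : ℝ) := by
    exact_mod_cast Nat.one_le_pow _ _ (by omega)
  have h2 : (1 : ℝ) ≤ ((d : ℝ) + 1) * (1 + 4 * (((d : ℝ) + 1) * N)) := by
    have a : (1 : ℝ) ≤ (d : ℝ) + 1 := by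
      have : (0 : ℝ) ≤ d := Nat.cast_nonneg d
      linarith
    have b : (1 : ℝ) ≤ 1 + 4 * (((d : ℝ) + 1) * N) := by
      have : (0 : ℝ) ≤ 4 * (((d : ℝ) + 1) * N) := by positivity
      linarith
    nlinarith
  unfold cWb
  calc (1 : ℝ) = 1 * 1 := (mul_one 1).symm
    _ ≤ _ := mul_le_mul h1 h2 zero_le_one (zero_le_one.trans h1)

/-- [folklore] **SUP BOUND FOR `Πᵀ_bm`:** `|(Πᵀ_bm g)_α(q)| ≤ cWb·M` if `|g| ≤ M` on the window bonds at `q` (in-block root). -/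
theorem abs_coProjBmAt_le {N : ℕ} (hN : 1 ≤ N) {r : Fin (d + 1) → ℕ} (hr : r ∈ box (d + 1) N) (g : Form1 (d + 1) ℝ)
    (α : Fin (d + 1)) (q : Fin (d + 1) → ℤ) {M : ℝ}
    (hM : ∀ (κ : Fin (d + 1)) (v : Fin (d + 1) → ℤ), v ∈ cube (d + 1) N → |g κ (q + v)| ≤ M) :
    |coProjBmAt (toSite r) N g α q| ≤ cWb d N * M := by
  rw [coProjBmAt_apply]
  calc |∑ v ∈ cube (d + 1) N, ∑ β : Fin (d + 1), pmBm (toSite r) N β (q + v) α q * g β (q + v)|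
      ≤ ∑ v ∈ cube (d + 1) N, |∑ β : Fin (d + 1), pmBm (toSite r) N β (q + v) α q * g β (q + v)| :=
        Finset.abs_sum_le_sum_abs _ _
    _ ≤ ∑ v ∈ cube (d + 1) N, ∑ _β : Fin (d + 1), (1 + 4 * (((d : ℝ) + 1) * N)) * M :=
        Finset.sum_le_sum fun v hv => (Finset.abs_sum_le_sum_abs _ _).trans
          (Finset.sum_le_sum fun β _ => by
            rw [abs_mul]
            exact mul_le_mul (abs_pmBm_le hN hr β (q + v) α q) (hM β v hv) (abs_nonneg _) (by positivity))
    _ = cWb d N * M := by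
        rw [Finset.sum_const, Finset.sum_const, Finset.card_univ, Fintype.card_fin, card_cube]
        simp only [nsmul_eq_mul]
        unfold cWb
        push_cast
        ring

/-- [folklore] **`Πᵀ_bm` IS COARSE-TRANSLATION COVARIANT**: `Πᵀ_bm (g ∘ shift (N•z)) (α, q) = (Πᵀ_bm g)(α, q + N•z)`. -/
theorem coProjBmAt_shift (ρ : Fin (d + 1) → ℤ) {N : ℕ} (hN : 1 ≤ N) (g : Form1 (d + 1) ℝ) (z : Fin (d + 1) → ℤ)
    (α : Fin (d + 1)) (q : Fin (d + 1) → ℤ) :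
    coProjBmAt ρ N (fun κ u => g κ (u + (N : ℤ) • z)) α q = coProjBmAt ρ N g α (q + (N : ℤ) • z) := by
  rw [coProjBmAt_apply, coProjBmAt_apply]
  refine Finset.sum_congr rfl fun v _ => Finset.sum_congr rfl fun β _ => ?_
  rw [add_right_comm q ((N : ℤ) • z) v, pmBm_shift ρ hN]

end Window

/-! ## §2 The leg dressings in window form and their identification with the comp form -/

section Legs

/-- [folklore] `Πᵀ_bm` on the FIRST leg of a kernel table (`inl` components; multiplier legs untouched). -/
def legCo₁BmAt (ρ : Fin (d + 1) → ℤ) (N : ℕ) (K : MKer (d + 1) (Fib d)) : MKer (d + 1) (Fib d) :=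
  fun x y a b =>
    match a with
    | Sum.inl α => coProjBmAt ρ N (fun α' x' => K x' y (Sum.inl α') b) α x
    | Sum.inr _ => K x y a b

/-- [folklore] `Πᵀ_bm` on the SECOND leg of a kernel table. -/
def legCo₂BmAt (ρ : Fin (d + 1) → ℤ) (N : ℕ) (K : MKer (d + 1) (Fib d)) : MKer (d + 1) (Fib d) :=
  fun x y a b =>
    match b with
    | Sum.inl β => coProjBmAt ρ N (fun β' y' => K x y' a (Sum.inl β')) β y
    | Sum.inr _ => K x y a b

variable (ρ : Fin (d + 1) → ℤ) (N : ℕ)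

/-- [folklore] Computation rule, first leg, field component. -/
theorem legCo₁BmAt_inl (K : MKer (d + 1) (Fib d)) (x y : Fin (d + 1) → ℤ) (α : Fin (d + 1)) (b : Fib d) :
    legCo₁BmAt ρ N K x y (Sum.inl α) b = coProjBmAt ρ N (fun α' x' => K x' y (Sum.inl α') b) α x := rfl

/-- [folklore] Computation rule, first leg, multiplier component. -/
theorem legCo₁BmAt_inr (K : MKer (d + 1) (Fib d)) (x y : Fin (d + 1) → ℤ) (m : Fin (d + 1)) (b : Fib d) :
    legCo₁BmAt ρ N K x y (Sum.inr m) b = K x y (Sum.inr m) b := rfl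

/-- [folklore] Computation rule, second leg, field component. -/
theorem legCo₂BmAt_inl (K : MKer (d + 1) (Fib d)) (x y : Fin (d + 1) → ℤ) (a : Fib d) (β : Fin (d + 1)) :
    legCo₂BmAt ρ N K x y a (Sum.inl β) = coProjBmAt ρ N (fun β' y' => K x y' a (Sum.inl β')) β y := rfl

/-- [folklore] Computation rule, second leg, multiplier component. -/
theorem legCo₂BmAt_inr (K : MKer (d + 1) (Fib d)) (x y : Fin (d + 1) → ℤ) (a : Fib d) (m : Fin (d + 1)) :
    legCo₂BmAt ρ N K x y a (Sum.inr m) = K x y a (Sum.inr m) := rfl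

/-- [folklore] Fibre contraction against a ROW of `piKBm`, field row: a windowed `pmBm`-sum. -/
theorem sum_piKBm_mul_inl (x x' : Fin (d + 1) → ℤ) (α : Fin (d + 1)) (g : Fib d → ℝ) :
    ∑ f : Fib d, piKBm ρ N x x' (Sum.inl α) f * g f =
      if x' - x ∈ cube (d + 1) N then ∑ β : Fin (d + 1), pmBm ρ N β x' α x * g (Sum.inl β) else 0 := by
  rw [Fintype.sum_sum_type]
  simp only [piKBm_inl_inl, piKBm_inl_inr, zero_mul, Finset.sum_const_zero, add_zero]
  split_ifs
  · rfl
  · simp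

/-- [folklore] Fibre contraction against a ROW of `piKBm`, multiplier row: the Kronecker delta. -/
theorem sum_piKBm_mul_inr (x x' : Fin (d + 1) → ℤ) (m : Fin (d + 1)) (g : Fib d → ℝ) :
    ∑ f : Fib d, piKBm ρ N x x' (Sum.inr m) f * g f = if x = x' then g (Sum.inr m) else 0 := by
  rw [Fintype.sum_sum_type]
  simp only [piKBm_inr_inl, piKBm_inr_inr, zero_mul, Finset.sum_const_zero, zero_add]
  by_cases h : x = x'
  · simp only [h, true_and, ite_mul, one_mul, zero_mul, Finset.sum_ite_eq, Finset.mem_univ, if_true]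
  · simp [h]

/-- [folklore] Fibre contraction against a COLUMN of `piKBm` (a row of `trK piKBm`), field column. -/
theorem sum_mul_piKBm_inl (y y' : Fin (d + 1) → ℤ) (β : Fin (d + 1)) (g : Fib d → ℝ) :
    ∑ f : Fib d, g f * piKBm ρ N y y' (Sum.inl β) f =
      if y' - y ∈ cube (d + 1) N then ∑ β' : Fin (d + 1), pmBm ρ N β' y' β y * g (Sum.inl β') else 0 := by
  rw [Fintype.sum_sum_type]
  simp only [piKBm_inl_inl, piKBm_inl_inr, mul_zero, Finset.sum_const_zero, add_zero]
  split_ifs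
  · exact Finset.sum_congr rfl fun β' _ => mul_comm _ _
  · simp

/-- [folklore] Fibre contraction against a COLUMN of `piKBm`, multiplier column. -/
theorem sum_mul_piKBm_inr (y y' : Fin (d + 1) → ℤ) (m : Fin (d + 1)) (g : Fib d → ℝ) :
    ∑ f : Fib d, g f * piKBm ρ N y y' (Sum.inr m) f = if y = y' then g (Sum.inr m) else 0 := by
  rw [Fintype.sum_sum_type]
  simp only [piKBm_inr_inl, piKBm_inr_inr, mul_zero, Finset.sum_const_zero, zero_add]
  by_cases h : y = y'
  · simp only [h, true_and, mul_ite, mul_one, mul_zero, Finset.sum_ite_eq, Finset.mem_univ, if_true]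
  · simp [h]

/-- [folklore] **`Πᵀ_bm` ON THE FIRST LEG IS LEFT COMPOSITION WITH `piKBm`**: `legCo₁BmAt ρ N K = comp (piKBm ρ N) K`. -/
theorem legCo₁BmAt_eq_comp (K : MKer (d + 1) (Fib d)) : legCo₁BmAt ρ N K = comp (piKBm ρ N) K := by
  funext x y a b
  rcases a with α | m
  · rw [legCo₁BmAt_inl, coProjBmAt_apply]
    unfold ExpKernelCalculus.comp
    simp_rw [sum_piKBm_mul_inl]
    rw [tsum_window]
  · rw [legCo₁BmAt_inr]
    unfold ExpKernelCalculus.comp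
    simp_rw [sum_piKBm_mul_inr]
    rw [tsum_point]

/-- [folklore] **`Πᵀ_bm` ON THE SECOND LEG IS RIGHT COMPOSITION WITH `trK piKBm`**: `legCo₂BmAt ρ N K = comp K (trK (piKBm ρ N))`. -/
theorem legCo₂BmAt_eq_comp (K : MKer (d + 1) (Fib d)) : legCo₂BmAt ρ N K = comp K (trK (piKBm ρ N)) := by
  funext x y a b
  rcases b with β | m
  · rw [legCo₂BmAt_inl, coProjBmAt_apply]
    unfold ExpKernelCalculus.comp
    simp only [trK]
    simp_rw [sum_mul_piKBm_inl]
    rw [tsum_window]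
  · rw [legCo₂BmAt_inr]
    unfold ExpKernelCalculus.comp
    simp only [trK]
    simp_rw [sum_mul_piKBm_inr]
    rw [tsum_point]

/-- [folklore] **THE COMP-FORM DRESSING IS THE TWO LEG DRESSINGS**: `dressKBmAt ρ N K = legCo₂BmAt ρ N (legCo₁BmAt ρ N K)`. -/
theorem dressKBmAt_eq_legs (K : MKer (d + 1) (Fib d)) : dressKBmAt ρ N K = legCo₂BmAt ρ N (legCo₁BmAt ρ N K) := by
  rw [legCo₂BmAt_eq_comp, legCo₁BmAt_eq_comp]
  rfl

end Legs

/-! ## §3 Bi-localisation survives the block-mean leg dressings (same rate) -/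

section LegBounds

/-- [folklore] The block-mean dressing constant of one leg: `cKb := cWb d N · exp(δ(d+1)N)`. -/
def cKb (d N : ℕ) (δ : ℝ) : ℝ := cWb d N * Real.exp (δ * (((d : ℝ) + 1) * N))

/-- [folklore] `0 ≤ cKb`. -/
theorem cKb_nonneg (d N : ℕ) (δ : ℝ) : 0 ≤ cKb d N δ := by
  unfold cKb
  exact mul_nonneg (cWb_nonneg _ _) (Real.exp_pos _).le

/-- [folklore] `1 ≤ cKb` (`0 ≤ δ`). -/
theorem one_le_cKb (d N : ℕ) {δ : ℝ} (hδ : 0 ≤ δ) : 1 ≤ cKb d N δ := by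
  have h12 := one_le_cWb d N
  have h3 : (1 : ℝ) ≤ Real.exp (δ * (((d : ℝ) + 1) * N)) := Real.one_le_exp (by positivity)
  unfold cKb
  calc (1 : ℝ) = 1 * 1 := (mul_one 1).symm
    _ ≤ cWb d N * Real.exp (δ * (((d : ℝ) + 1) * N)) := mul_le_mul h12 h3 zero_le_one (zero_le_one.trans h12)

/-- [folklore] **FIRST-LEG BLOCK-MEAN DRESSING PRESERVES BI-LOCALISATION:** `BiLoc K p q C δ ⇒ BiLoc (legCo₁BmAt ρ N K) p q (cKb·C) δ`
(in-block root `ρ = toSite r`, `1 ≤ N`, `0 ≤ δ`). -/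
theorem biLoc_legCo₁BmAt {N : ℕ} (hN : 1 ≤ N) {r : Fin (d + 1) → ℕ} (hr : r ∈ box (d + 1) N)
    {K : MKer (d + 1) (Fib d)} {p q : Fin (d + 1) → ℤ} {C δ : ℝ}
    (h : BiLoc K p q C δ) (hδ : 0 ≤ δ) : BiLoc (legCo₁BmAt (toSite r) N K) p q (cKb d N δ * C) δ := by
  have hC : 0 ≤ C := h.nonneg (Sum.inl 0)
  intro x y a b
  cases a with
  | inr m =>
    rw [legCo₁BmAt_inr]
    calc |K x y (Sum.inr m) b| ≤ C * Real.exp (-δ * (l1 (x - p) + l1 (y - q))) := h x y _ b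
      _ ≤ cKb d N δ * C * Real.exp (-δ * (l1 (x - p) + l1 (y - q))) := by
          have h1 := one_le_cKb d N hδ
          have h2 : 0 ≤ C * Real.exp (-δ * (l1 (x - p) + l1 (y - q))) := by positivity
          nlinarith
  | inl α =>
    rw [legCo₁BmAt_inl]
    have hM : ∀ (κ : Fin (d + 1)) (v : Fin (d + 1) → ℤ), v ∈ cube (d + 1) N →
        |K (x + v) y (Sum.inl κ) b| ≤ C * Real.exp (δ * (((d : ℝ) + 1) * N)) * Real.exp (-δ * (l1 (x - p) + l1 (y - q))) :=
      fun κ v hv => (h (x + v) y _ b).trans (exp_recenter_le (l1_sub_window_le x hv) hC hδ)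
    calc |coProjBmAt (toSite r) N (fun α' x' => K x' y (Sum.inl α') b) α x|
        ≤ cWb d N * (C * Real.exp (δ * (((d : ℝ) + 1) * N)) * Real.exp (-δ * (l1 (x - p) + l1 (y - q)))) :=
          abs_coProjBmAt_le hN hr _ α x hM
      _ = cKb d N δ * C * Real.exp (-δ * (l1 (x - p) + l1 (y - q))) := by
          unfold cKb
          ring

/-- [folklore] **SECOND-LEG BLOCK-MEAN DRESSING PRESERVES BI-LOCALISATION.** -/
theorem biLoc_legCo₂BmAt {N : ℕ} (hN : 1 ≤ N) {r : Fin (d + 1) → ℕ} (hr : r ∈ box (d + 1) N)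
    {K : MKer (d + 1) (Fib d)} {p q : Fin (d + 1) → ℤ} {C δ : ℝ}
    (h : BiLoc K p q C δ) (hδ : 0 ≤ δ) : BiLoc (legCo₂BmAt (toSite r) N K) p q (cKb d N δ * C) δ := by
  have hC : 0 ≤ C := h.nonneg (Sum.inl 0)
  intro x y a b
  cases b with
  | inr m =>
    rw [legCo₂BmAt_inr]
    calc |K x y a (Sum.inr m)| ≤ C * Real.exp (-δ * (l1 (x - p) + l1 (y - q))) := h x y a _
      _ ≤ cKb d N δ * C * Real.exp (-δ * (l1 (x - p) + l1 (y - q))) := by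
          have h1 := one_le_cKb d N hδ
          have h2 : 0 ≤ C * Real.exp (-δ * (l1 (x - p) + l1 (y - q))) := by positivity
          nlinarith
  | inl β =>
    rw [legCo₂BmAt_inl]
    have hM : ∀ (κ : Fin (d + 1)) (v : Fin (d + 1) → ℤ), v ∈ cube (d + 1) N →
        |K x (y + v) a (Sum.inl κ)| ≤ C * Real.exp (δ * (((d : ℝ) + 1) * N)) * Real.exp (-δ * (l1 (y - q) + l1 (x - p))) := by
      intro κ v hv
      have h1 := h x (y + v) a (Sum.inl κ)
      rw [add_comm (l1 (x - p)) (l1 (y + v - q))] at h1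
      exact h1.trans (exp_recenter_le (l1_sub_window_le y hv) hC hδ)
    calc |coProjBmAt (toSite r) N (fun β' y' => K x y' a (Sum.inl β')) β y|
        ≤ cWb d N * (C * Real.exp (δ * (((d : ℝ) + 1) * N)) * Real.exp (-δ * (l1 (y - q) + l1 (x - p)))) :=
          abs_coProjBmAt_le hN hr _ β y hM
      _ = cKb d N δ * C * Real.exp (-δ * (l1 (x - p) + l1 (y - q))) := by
          unfold cKb
          rw [add_comm (l1 (y - q))]
          ring

/-- [folklore] **THE BLOCK-MEAN KERNEL DRESSING PRESERVES BI-LOCALISATION:** `BiLoc K p q C δ ⇒ BiLoc (dressKBmAt ρ N K) p q (cKb²·C) δ`. -/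
theorem biLoc_dressKBmAt {N : ℕ} (hN : 1 ≤ N) {r : Fin (d + 1) → ℕ} (hr : r ∈ box (d + 1) N)
    {K : MKer (d + 1) (Fib d)} {p q : Fin (d + 1) → ℤ} {C δ : ℝ}
    (h : BiLoc K p q C δ) (hδ : 0 ≤ δ) : BiLoc (dressKBmAt (toSite r) N K) p q (cKb d N δ * (cKb d N δ * C)) δ := by
  rw [dressKBmAt_eq_legs]
  exact biLoc_legCo₂BmAt hN hr (biLoc_legCo₁BmAt hN hr h hδ) hδ

end LegBounds

end

end Summit.QuantumFields.BalabanUV.Beta.AxialDressingRooted
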